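import Summits.CriticalPhenomena.PercolationContinuityZ3.Theorems.PercNearOneGluingNoHeavyLowerTailFibreSwitching
import Summits.CriticalPhenomena.PercolationContinuityZ3.Theorems.PercNearOneGluingNoHeavyLowerTailAntipodalSubmodularKernel
import HarnessLib

/-!
# `NoHeavyLowerTail` (stmt-CriticalPhenomena-4575) — ENVIRONMENT DECOMPOSITION of three-copy fibres:
# conditioned on one copy, a fibre is an antipodal interval fibre; hence every chain-nonnegative submodular
# two-copy kernel has nonnegative ENVIRONMENT-CONDITIONED fibre sums

Support file (new-inequality factory seat `prim-ineq-gen-1`, gen 6; `--supports stmt-CriticalPhenomena-4575`).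
No named facts, no sorries.

Setting (`FibreSwitching`): configurations are finite sets of coordinates, a triple `x : Fin 3 → Finset ι` inside
`D` has the PROFILE `e ↦ #{i : e ∈ x i}` and `fibre D k` is the set of triples with profile `k`.

**Lemma (environment decomposition).**  Fix the third copy `ω = x 2` of a fibre element.  Then the coordinates
of `D` lying in BOTH other copies form the set `forced D k ω = {e ∈ D : k e = [e ∈ ω] + 2}` and the coordinates
lying in EXACTLY ONE of them form `free D k ω = {e ∈ D : k e = [e ∈ ω] + 1}`; so `x 0 = forced ∪ Y`,
`x 1 = forced ∪ (free ∖ Y)` with `Y = free ∩ x 0` (`eq_trip_of_mem_fibre`), and conversely every `Y ⊆ free`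
occurs (`trip_mem_fibre`): the elements of the fibre with third copy `ω` are in bijection with the ANTIPODAL
pairs of the interval `[forced, forced ∪ free]` (`filter_fibre_eq_image`).

**Theorem (`sum_fibre_env_kernel_nonneg`).**  For every preorder `Q`, every monotone `lam : Finset ι → Q`,
every kernel `κ : Q → Q → ℝ` that is nonnegative on chains and submodular on comparable rectangles
(`AntipodalSubmodularKernel`), every nonnegative weight `g` of the third copy and every profile `k`:
  `0 ≤ Σ_{x ∈ fibre D k} g (x 2) · κ (lam (x 0)) (lam (x 1))`.
This is the formal core of the factory's bookkeeping "the antipodal (P₂) slack of every environment is ≥ 0"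
(FINDING-6: `s_A, s_B, s_C ≥ 0`; the environment-conditioned `Cone(M₃)` / `Cone(Π₄)` columns of the step LPs of
FINDING-10/12 — e.g. the terminal-operation closure certificates of FINDING-12 §2 are nonnegative combinations of
an induction hypothesis and sums of exactly this form).  By the symmetry of fibres under permuting the copies
(`FibreSHK3.sum_fibre_comp_perm`) the same holds with any copy as the environment.
-/

namespace Summit.CriticalPhenomena.PercolationContinuityZ3.Theorems

namespace FibreEnv

open Finset FibreSwitching AntipodalSubmodularKernel
open Literature.Probability.Percolation.DecisionTree

noncomputable section

open Classical

variable {ι : Type*} [DecidableEq ι]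

/-! ### The profile, coordinatewise -/

/-- The profile at `e` is the number of copies containing `e`, written as a sum of three indicators. [this work] -/
theorem profile_apply (x : Fin 3 → Finset ι) (e : ι) :
    profile x e = (if e ∈ x 0 then 1 else 0) + (if e ∈ x 1 then 1 else 0) + (if e ∈ x 2 then 1 else 0) := by
  unfold profile
  rw [Fin.sum_univ_three]

/-- Membership in a fibre: inside `D` with the prescribed profile. [this work] -/
theorem mem_fibre_iff {D : Finset ι} {k : ι → ℕ} {x : Fin 3 → Finset ι} :
    x ∈ fibre D k ↔ x ∈ triples D ∧ profile x = k := by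
  unfold fibre; rw [mem_filter]

/-! ### Forced and free coordinates of an environment -/

/-- Coordinates of `D` that lie in BOTH non-environment copies, given the environment `ω` and the profile `k`. [this work] -/
def forced (D : Finset ι) (k : ι → ℕ) (ω : Finset ι) : Finset ι :=
  D.filter fun e => k e = (if e ∈ ω then 1 else 0) + 2

/-- Coordinates of `D` that lie in EXACTLY ONE non-environment copy. [this work] -/
def free (D : Finset ι) (k : ι → ℕ) (ω : Finset ι) : Finset ι :=
  D.filter fun e => k e = (if e ∈ ω then 1 else 0) + 1

/-- Membership in `forced`. [this work] -/
theorem mem_forced {D : Finset ι} {k : ι → ℕ} {ω : Finset ι} {e : ι} :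
    e ∈ forced D k ω ↔ e ∈ D ∧ k e = (if e ∈ ω then 1 else 0) + 2 := by
  unfold forced; rw [mem_filter]

/-- Membership in `free`. [this work] -/
theorem mem_free {D : Finset ι} {k : ι → ℕ} {ω : Finset ι} {e : ι} :
    e ∈ free D k ω ↔ e ∈ D ∧ k e = (if e ∈ ω then 1 else 0) + 1 := by
  unfold free; rw [mem_filter]

/-- `forced ⊆ D`. [this work] -/
theorem forced_subset (D : Finset ι) (k : ι → ℕ) (ω : Finset ι) : forced D k ω ⊆ D := filter_subset _ _

/-- `free ⊆ D`. [this work] -/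
theorem free_subset (D : Finset ι) (k : ι → ℕ) (ω : Finset ι) : free D k ω ⊆ D := filter_subset _ _

/-- `forced` and `free` are disjoint. [this work] -/
theorem disjoint_forced_free (D : Finset ι) (k : ι → ℕ) (ω : Finset ι) :
    Disjoint (forced D k ω) (free D k ω) := by
  rw [Finset.disjoint_left]
  intro e h1 h2
  rw [mem_forced] at h1
  rw [mem_free] at h2
  omega

/-! ### The triple built from an antipodal pair of the interval `[forced, forced ∪ free]` -/

/-- The triple `(forced ∪ Y, forced ∪ (free ∖ Y), ω)`. [this work] -/
def trip (D : Finset ι) (k : ι → ℕ) (ω Y : Finset ι) : Fin 3 → Finset ι :=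
  fun i => if i = 0 then forced D k ω ∪ Y else if i = 1 then forced D k ω ∪ (free D k ω \ Y) else ω

/-- Component `0` of `trip`. [this work] -/
@[simp] theorem trip_zero (D : Finset ι) (k : ι → ℕ) (ω Y : Finset ι) :
    trip D k ω Y 0 = forced D k ω ∪ Y := by simp [trip]
/-- Component `1` of `trip`. [this work] -/
@[simp] theorem trip_one (D : Finset ι) (k : ι → ℕ) (ω Y : Finset ι) :
    trip D k ω Y 1 = forced D k ω ∪ (free D k ω \ Y) := by simp [trip]
/-- Component `2` of `trip`. [this work] -/
@[simp] theorem trip_two (D : Finset ι) (k : ι → ℕ) (ω Y : Finset ι) : trip D k ω Y 2 = ω := by simp [trip]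

/-! ### Decomposition of a fibre element by its environment -/

section Decomp

variable {D : Finset ι} {k : ι → ℕ} {x : Fin 3 → Finset ι}

/-- In a fibre element, copy `0` is `forced ∪ (free ∩ copy 0)` (environment = copy `2`). [this work] -/
theorem copy_zero_eq (hx : x ∈ fibre D k) : x 0 = forced D k (x 2) ∪ (free D k (x 2) ∩ x 0) := by
  obtain ⟨hxD, hprof⟩ := mem_fibre_iff.1 hx
  have hsub := mem_triples.1 hxD
  ext e
  have hk := congrFun hprof e
  rw [profile_apply] at hk
  rw [mem_union, mem_inter, mem_forced, mem_free]
  constructor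
  · intro h0
    have hD : e ∈ D := hsub 0 h0
    rw [if_pos h0] at hk
    by_cases h1 : e ∈ x 1
    · rw [if_pos h1] at hk
      left
      refine ⟨hD, ?_⟩
      by_cases h2 : e ∈ x 2
      · rw [if_pos h2] at hk ⊢; omega
      · rw [if_neg h2] at hk ⊢; omega
    · rw [if_neg h1] at hk
      right
      refine ⟨⟨hD, ?_⟩, h0⟩
      by_cases h2 : e ∈ x 2
      · rw [if_pos h2] at hk ⊢; omega
      · rw [if_neg h2] at hk ⊢; omega
  · rintro (⟨-, hke⟩ | ⟨-, h0⟩)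
    · by_contra h0
      rw [if_neg h0] at hk
      by_cases h1 : e ∈ x 1
      · rw [if_pos h1] at hk
        by_cases h2 : e ∈ x 2
        · rw [if_pos h2] at hk hke; omega
        · rw [if_neg h2] at hk hke; omega
      · rw [if_neg h1] at hk
        by_cases h2 : e ∈ x 2
        · rw [if_pos h2] at hk hke; omega
        · rw [if_neg h2] at hk hke; omega
    · exact h0

/-- In a fibre element, copy `1` is `forced ∪ (free ∖ copy 0)`. [this work] -/
theorem copy_one_eq (hx : x ∈ fibre D k) : x 1 = forced D k (x 2) ∪ (free D k (x 2) \ x 0) := by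
  obtain ⟨hxD, hprof⟩ := mem_fibre_iff.1 hx
  have hsub := mem_triples.1 hxD
  ext e
  have hk := congrFun hprof e
  rw [profile_apply] at hk
  rw [mem_union, mem_sdiff, mem_forced, mem_free]
  constructor
  · intro h1
    have hD : e ∈ D := hsub 1 h1
    rw [if_pos h1] at hk
    by_cases h0 : e ∈ x 0
    · rw [if_pos h0] at hk
      left
      refine ⟨hD, ?_⟩
      by_cases h2 : e ∈ x 2
      · rw [if_pos h2] at hk ⊢; omega
      · rw [if_neg h2] at hk ⊢; omega
    · rw [if_neg h0] at hk
      right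
      refine ⟨⟨hD, ?_⟩, h0⟩
      by_cases h2 : e ∈ x 2
      · rw [if_pos h2] at hk ⊢; omega
      · rw [if_neg h2] at hk ⊢; omega
  · rintro (⟨-, hke⟩ | ⟨⟨-, hke⟩, h0⟩)
    · by_contra h1
      rw [if_neg h1] at hk
      by_cases h0 : e ∈ x 0
      · rw [if_pos h0] at hk
        by_cases h2 : e ∈ x 2
        · rw [if_pos h2] at hk hke; omega
        · rw [if_neg h2] at hk hke; omega
      · rw [if_neg h0] at hk
        by_cases h2 : e ∈ x 2
        · rw [if_pos h2] at hk hke; omega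
        · rw [if_neg h2] at hk hke; omega
    · by_contra h1
      rw [if_neg h1, if_neg h0] at hk
      by_cases h2 : e ∈ x 2
      · rw [if_pos h2] at hk hke; omega
      · rw [if_neg h2] at hk hke; omega

/-- Outside `forced ∪ free`, the profile equals the environment's indicator (for a realised environment). [this work] -/
theorem profile_off (hx : x ∈ fibre D k) {e : ι} (hF : e ∉ forced D k (x 2)) (hW : e ∉ free D k (x 2)) :
    k e = (if e ∈ x 2 then 1 else 0) := by
  obtain ⟨hxD, hprof⟩ := mem_fibre_iff.1 hx
  have hsub := mem_triples.1 hxD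
  have hk := congrFun hprof e
  rw [profile_apply] at hk
  rw [mem_forced, not_and] at hF
  rw [mem_free, not_and] at hW
  by_cases hD : e ∈ D
  · have hF' := hF hD
    have hW' := hW hD
    by_cases h0 : e ∈ x 0
    · rw [if_pos h0] at hk
      by_cases h1 : e ∈ x 1
      · rw [if_pos h1] at hk
        by_cases h2 : e ∈ x 2
        · rw [if_pos h2] at hk hF' hW' ⊢; omega
        · rw [if_neg h2] at hk hF' hW' ⊢; omega
      · rw [if_neg h1] at hk
        by_cases h2 : e ∈ x 2
        · rw [if_pos h2] at hk hF' hW' ⊢; omega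
        · rw [if_neg h2] at hk hF' hW' ⊢; omega
    · rw [if_neg h0] at hk
      by_cases h1 : e ∈ x 1
      · rw [if_pos h1] at hk
        by_cases h2 : e ∈ x 2
        · rw [if_pos h2] at hk hF' hW' ⊢; omega
        · rw [if_neg h2] at hk hF' hW' ⊢; omega
      · rw [if_neg h1] at hk
        by_cases h2 : e ∈ x 2
        · rw [if_pos h2] at hk hF' hW' ⊢; omega
        · rw [if_neg h2] at hk hF' hW' ⊢; omega
  · have h0 : e ∉ x 0 := fun h => hD (hsub 0 h)
    have h1 : e ∉ x 1 := fun h => hD (hsub 1 h)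
    have h2 : e ∉ x 2 := fun h => hD (hsub 2 h)
    rw [if_neg h0, if_neg h1, if_neg h2] at hk
    rw [if_neg h2]
    omega

/-- A fibre element IS the triple built from `Y = free ∩ copy 0` and its environment. [this work] -/
theorem eq_trip_of_mem_fibre (hx : x ∈ fibre D k) : x = trip D k (x 2) (free D k (x 2) ∩ x 0) := by
  funext i
  fin_cases i
  · simpa using copy_zero_eq hx
  · rw [show ((⟨1, by norm_num⟩ : Fin 3)) = 1 from rfl, trip_one, copy_one_eq hx]
    congr 1
    ext e
    simp only [mem_sdiff, mem_inter, not_and]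
    tauto
  · rfl

end Decomp

/-! ### Every antipodal pair of the interval occurs -/

section Occurs

variable {D : Finset ι} {k : ι → ℕ} {xs : Fin 3 → Finset ι}

/-- Indicator bookkeeping on the interval: for `Y ⊆ free`, at every coordinate
`[e ∈ forced ∪ Y] + [e ∈ forced ∪ (free ∖ Y)] = 2·[e ∈ forced] + [e ∈ free]`. [this work] -/
theorem indicator_trip (ω : Finset ι) {Y : Finset ι} (hY : Y ⊆ free D k ω) (e : ι) :
    (if e ∈ forced D k ω ∪ Y then 1 else 0) + (if e ∈ forced D k ω ∪ (free D k ω \ Y) then 1 else 0) =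
      2 * (if e ∈ forced D k ω then 1 else 0) + (if e ∈ free D k ω then 1 else 0) := by
  have hdis := disjoint_forced_free D k ω
  by_cases hF : e ∈ forced D k ω
  · have hW : e ∉ free D k ω := fun h => Finset.disjoint_left.1 hdis hF h
    simp [hF, hW]
  · by_cases hW : e ∈ free D k ω
    · by_cases hY' : e ∈ Y
      · simp [hF, hW, hY']
      · simp [hF, hW, hY']
    · have hY' : e ∉ Y := fun h => hW (hY h)
      simp [hF, hW, hY']

/-- If the environment `xs 2` is realised by SOME fibre element `xs`, then for every `Y ⊆ free` the triple
`(forced ∪ Y, forced ∪ (free ∖ Y), xs 2)` lies in the fibre. [this work] -/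
theorem trip_mem_fibre (hxs : xs ∈ fibre D k) {Y : Finset ι} (hY : Y ⊆ free D k (xs 2)) :
    trip D k (xs 2) Y ∈ fibre D k := by
  obtain ⟨hxsD, hprof⟩ := mem_fibre_iff.1 hxs
  have hsub := mem_triples.1 hxsD
  refine mem_fibre_iff.2 ⟨?_, ?_⟩
  · rw [mem_triples]
    intro i
    fin_cases i
    · simpa using Finset.union_subset (forced_subset D k _) (hY.trans (free_subset D k _))
    · simpa using Finset.union_subset (forced_subset D k _) (sdiff_subset.trans (free_subset D k _))
    · simpa using hsub 2
  · funext e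
    rw [profile_apply, trip_zero, trip_one, trip_two, indicator_trip (xs 2) hY e]
    -- compare with the profile of `xs` itself, decomposed the same way
    have hk := congrFun hprof e
    rw [profile_apply, copy_zero_eq hxs, copy_one_eq hxs] at hk
    have hY0 : free D k (xs 2) ∩ xs 0 ⊆ free D k (xs 2) := inter_subset_left
    have h2 := indicator_trip (D := D) (k := k) (xs 2) hY0 e
    have e1 : free D k (xs 2) \ (free D k (xs 2) ∩ xs 0) = free D k (xs 2) \ xs 0 := by
      ext f; simp only [mem_sdiff, mem_inter, not_and]; tauto
    rw [e1] at h2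
    omega

end Occurs

/-! ### The fibre elements with a given environment = the image of the interval's power set -/

section Image

variable {D : Finset ι} {k : ι → ℕ} {xs : Fin 3 → Finset ι}

/-- `trip` is injective on subsets of `free` (read `Y` off copy `0`). [this work] -/
theorem trip_inj (ω : Finset ι) {Y Y' : Finset ι} (hY : Y ⊆ free D k ω) (hY' : Y' ⊆ free D k ω)
    (h : trip D k ω Y = trip D k ω Y') : Y = Y' := by
  have h0 := congrFun h 0
  rw [trip_zero, trip_zero] at h0
  have hdis := disjoint_forced_free D k ω
  ext e
  constructor
  · intro he
    have : e ∈ forced D k ω ∪ Y' := h0 ▸ mem_union_right _ he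
    rcases mem_union.1 this with hF | hY2
    · exact absurd (hY he) (Finset.disjoint_left.1 hdis hF)
    · exact hY2
  · intro he
    have : e ∈ forced D k ω ∪ Y := h0.symm ▸ mem_union_right _ he
    rcases mem_union.1 this with hF | hY2
    · exact absurd (hY' he) (Finset.disjoint_left.1 hdis hF)
    · exact hY2

/-- **Environment decomposition.**  If `xs` is a fibre element, the fibre elements with the same third copy
are exactly the triples `trip Y`, `Y ⊆ free`. [this work] -/
theorem filter_fibre_eq_image (hxs : xs ∈ fibre D k) :
    (fibre D k).filter (fun x => x 2 = xs 2) = (free D k (xs 2)).powerset.image (trip D k (xs 2)) := by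
  ext x
  rw [mem_filter, mem_image]
  constructor
  · rintro ⟨hx, h2⟩
    refine ⟨free D k (xs 2) ∩ x 0, mem_powerset.2 inter_subset_left, ?_⟩
    rw [← h2]
    exact (eq_trip_of_mem_fibre hx).symm
  · rintro ⟨Y, hY, rfl⟩
    exact ⟨trip_mem_fibre hxs (mem_powerset.1 hY), trip_two D k _ Y⟩

/-- Re-summation: over the fibre elements with third copy `xs 2`, a function of copies `0,1` sums as over the
antipodal pairs of the interval `[forced, forced ∪ free]`. [this work] -/
theorem sum_filter_fibre_eq (hxs : xs ∈ fibre D k) {M : Type*} [AddCommMonoid M]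
    (f : Finset ι → Finset ι → M) :
    ∑ x ∈ (fibre D k).filter (fun x => x 2 = xs 2), f (x 0) (x 1) =
      ∑ Y ∈ (free D k (xs 2)).powerset,
        f (forced D k (xs 2) ∪ Y) (forced D k (xs 2) ∪ (free D k (xs 2) \ Y)) := by
  rw [filter_fibre_eq_image hxs, sum_image]
  · simp only [trip_zero, trip_one]
  · intro Y hY Y' hY' h
    exact trip_inj (xs 2) (mem_powerset.1 hY) (mem_powerset.1 hY') h

end Image

/-! ### Environment-conditioned antipodal kernels have nonnegative fibre sums -/

section Main

variable {Q : Type*} [Preorder Q]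

/-- **Theorem.**  Let `lam : Finset ι → Q` be monotone into a preorder, `κ : Q → Q → ℝ` nonnegative on chains and
submodular on comparable rectangles, `g ≥ 0` any weight of the third copy.  Then for every `D` and profile `k`,
`0 ≤ Σ_{x ∈ fibre D k} g (x 2) · κ (lam (x 0)) (lam (x 1))`.  Proof: group by the third copy; each group is an
antipodal interval fibre (`sum_filter_fibre_eq`) on which `AntipodalSubmodularKernel.antipodalSum_self_nonneg`
applies to `Y ↦ lam (forced ∪ Y)`. [this work] -/
theorem sum_fibre_env_kernel_nonneg (D : Finset ι) (k : ι → ℕ) (lam : Finset ι → Q)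
    (hlam : ∀ ⦃X Y : Finset ι⦄, X ⊆ Y → lam X ≤ lam Y) (κ : Q → Q → ℝ)
    (hpos : ∀ x y : Q, x ≤ y → 0 ≤ κ x y)
    (hsub : ∀ a₀ a₁ b₀ b₁ : Q, a₀ ≤ a₁ → b₀ ≤ b₁ → κ a₁ b₁ + κ a₀ b₀ ≤ κ a₁ b₀ + κ a₀ b₁)
    (g : Finset ι → ℝ) (hg : ∀ ω, 0 ≤ g ω) :
    0 ≤ ∑ x ∈ fibre D k, g (x 2) * κ (lam (x 0)) (lam (x 1)) := by
  rw [← sum_fiberwise_of_maps_to (g := fun x : Fin 3 → Finset ι => x 2) (t := (fibre D k).image fun x => x 2)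
    (fun x hx => mem_image_of_mem _ hx)]
  refine sum_nonneg fun ω hω => ?_
  obtain ⟨xs, hxs, rfl⟩ := mem_image.1 hω
  have hrew : ∑ x ∈ (fibre D k).filter (fun x => x 2 = xs 2), g (x 2) * κ (lam (x 0)) (lam (x 1)) =
      g (xs 2) * ∑ x ∈ (fibre D k).filter (fun x => x 2 = xs 2), κ (lam (x 0)) (lam (x 1)) := by
    rw [mul_sum]
    refine sum_congr rfl fun x hx => ?_
    rw [(mem_filter.1 hx).2]
  rw [hrew]
  refine mul_nonneg (hg _) ?_
  rw [sum_filter_fibre_eq hxs (fun A B => κ (lam A) (lam B))]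
  exact antipodalSum_self_nonneg κ hpos hsub (free D k (xs 2)) (fun Y => lam (forced D k (xs 2) ∪ Y))
    fun Y Y' hYY' => hlam (union_subset_union (subset_refl _) hYY')

end Main

end

end FibreEnv

end Summit.CriticalPhenomena.PercolationContinuityZ3.Theorems
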